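import Summits.BirchSwinnertonDyer.Rank1Residual.X1.RankZeroGoodLatticeDisplay
import HarnessLib

/-!
# Residual class X1 ∩ {r = 0}: the DOUBLE-TWIST road (route (B-ii) of the cell at the h308 level) —
# `BSD(E,p)` and Mazur's main conjecture at a rank-`0` leaf pair from Keller–Yin's IMC2 at `𝟙` used
# TWICE and a `p ∤ #Ш_an` certificate on an admissible DOUBLE twist; NO Schneider, NO `p`-adic height

HONEST FRAMING (cell `bsd-eis`, home `run/shared/lean/pub/bsd-eis/`, seat `bsd-eis-k5-c5` (g2);
FULL-BSD rank-≤1 programme, ladder row A3 = class X1 ∩ {r_an = 0}: good ANOMALOUS Eisenstein prime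
`p > 2`, `E[p]` reducible, parity type A forced by the class clause; crux 5 `MazurMCOnX1RankZero` of
route `EisensteinPrimes`, item stmt-BirchSwinnertonDyer-19035). Nothing here closes the item and
nothing is booked; no label moves. ONE definition (`DoubleTwistPartnerAt`, the per-pair certificate
datum of the road, nothing asserted) and ONE class-wide rider spelled from it
(`DoubleTwistShaAnUnitSupply`, `@[conjecture]`-free because it is a bare `def … : Prop` consumed only
as a hypothesis); everything else is a theorem over the PREPRINT statement `h308`
(`KellerYin2024.thm308_imc2_bdpValue_goodLattice_OPEN`, KY arXiv:2402.12781v2 Thm. 3.0.8 (IMC2) at `𝟙`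
∘ BDP for the good lattice — the body of crux 2 `GoodLatticeBDPValue`, type- and rank-agnostic as
typed: its hypothesis is `corank Sel(E/K) = 1`) and PUBLISHED named facts.

THE ROAD. Let `(E,p)` be a leaf pair (`RankZero.Leaf`: X1, `r_an = 0`, hence type A) and `E'` the
good lattice of its class (no rational `p`-line unramified at `p`; exists by Ribet's lemma, tree
theorem `GoodLatticeExists.ribet_exists_isIsogenous_noUnramifiedLine_holds`). For an admissible `K`
(`d_K` odd `< -4`, Heegner for `N_{E'}` and for `p`) with `ord_{s=1} L(E'^K,s) = 1`, the SWAPPED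
display at the good lattice (`X1.RankZeroGoodLatticeDisplay.displaySwap_at_goodLattice`, this seat g0,
from `h308` + CGLS 5.1.1 + GZ + Kolyvagin + GZK) gives `def_p(E') + def_p(E'^K) = 0`, so
`BSD(E',p) ⟸ BSD(E'^K,p)` (ky :63). The partner `E'^K` is an X1 pair of TYPE B and analytic rank `1`
AND IS AGAIN KY-NORMALISED (§1: a prime-to-`p` quadratic twist moves rational `p`-lines to rational
`p`-lines and preserves "unramified at `p`" — the sign-equivariant twist isomorphism of
`GVParityTwistTransportProofs`), so Keller–Yin's display applies to IT at a second admissible field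
`K'` (Heegner for `N_{E'^K}` and `p`, `L(E'^{(d_K d_{K'})},1) ≠ 0`): `def_p(E'^K) + def_p(E'^{KK'}) = 0`
(`KellerYinTheoremA.display_at_goodLattice`, ky, rank- and type-agnostic), i.e.
`BSD(E'^K,p) ⟸ BSD(E'^{KK'},p)` where `E'^{KK'} = E'^{(d_K d_{K'})}` is the DOUBLE twist — a REAL
quadratic twist of `E'`, again a rank-`0` TYPE-A leaf curve (even character, `(d_K d_{K'}/p) = 1`).
Hence **`def_p` is constant along admissible double twists inside the leaf**, and `BSD(E,p)` follows
from `BSD` at ANY curve isogenous to an admissible double twist — in particular from the finite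
certificate `ord_p #Ш(E_c/ℚ)_an = 0` there (Wuthrich 2014 Prop. 21, lever
`Wuthrich2014.bsdp_of_L_one_ne_zero_of_padicValRat_shaAn_eq_zero`). This is route (B-ii) of ky's
MEMO-1 §5.2 ("a second admissible twist + a Ш_an-unit certificate"), so far in the tree only at the
level of KY's TYPED rank-one display (`bsdp_of_classX1_of_analyticRank_eq_one_of_KY_OPEN_of_twist_shaAn_unit`,
x1a); here BOTH steps run at the h308 level, and the certificate may sit on any member of the double
twist's isogeny class (it must: on the good lattice's own twists `#Ш_an` carries the lattice's `μ`,
e.g. `11a2`).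

WHAT IT IS FOR. (i) Per pair: a kernel road for the 28 open A3 pairs of the cell's census whose OWN
isogeny class has `p ∣ #Ш_an` at every member (residue N1″: the direct certificate levers cannot fire)
— the double twist is a DIFFERENT isogeny class. (ii) Class-wide (sequel `X1/RankZeroDoubleTwistClass.lean`
and the companion `Theorems/EisensteinPrimesMazurMCOnX1RankZeroDoubleTwist.lean`): crux 5 ⟸ crux 2 +
an indivisibility rider + PUB, in place of the Schneider rider of Theorem B
(`X1.RankZeroGoodLatticeDisplay`, crux 6). Per pair the certificate is a finite exact computation (two
admissible fields, one rational L-value ratio).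

* §1 `noUnramifiedLine_of_smul_eq_quadraticTwist` — KY-normalisation survives a prime-to-`p` twist.
* §2 `bsdp_twist_of_h308_of_bsdp_doubleTwist` — `BSD(E'^K,p)` for the rank-one TYPE-B partner from
  `h308` at `(E'^K, K')` and `BSD` at a curve isogenous to the double twist; `…_of_shaAn_unit`.
* §3 `Leaf.bsdp_goodLattice_of_h308_of_bsdp_doubleTwist` (both displays), the certificate datum
  `DoubleTwistPartnerAt`, `Leaf.bsdp_goodLattice_of_h308_of_doubleTwistPartnerAt`.

References: [KellerYin2024] Thm. 3.0.8 (IMC2), proof of Thm. 4.2.1 (display); [CastellaGrossiLeeSkinner2022]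
Thm. 5.3.1 and its proof (5.4)–(5.7), Thm. 5.1.1; [Wuthrich2014] Thm. 16, Prop. 21; [GreenbergLNM1716]
Thm. 4.1; [MilneADT2006] I.7.3; [SilvermanAEC2009] X.5 Cor. 5.4; [Vatsal1999Duke]; HOME/bsd-eis-ky-MEMO-1.md
§5.2 (Theorem B, (B-ii)); HOME/TARGET.md §1.1 row A3.
-/

set_option autoImplicit false

noncomputable section

open scoped Classical

open WeierstrassCurve NumberField IsDedekindDomain Field Literature.NumberTheory.EllipticCurves
  Literature.NumberTheory.EllipticCurves.ModularForms Literature.NumberTheory.QuadraticFields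
  Literature.NumberTheory.EllipticCurves.Rank1Residual
  Literature.NumberTheory.GaloisRepresentations
  Literature.NumberTheory.EllipticCurves.CastellaGrossiLeeSkinner2022
  Literature.NumberTheory.EllipticCurves.KellerYin2024
  Summit.BirchSwinnertonDyer.Rank1Residual.X1.KellerYinGoodLattice
  Summit.BirchSwinnertonDyer.Rank1Residual.X1.KellerYinTheoremA
  Summit.BirchSwinnertonDyer.BirchSwinnertonDyer.Theorems
  Summit.BirchSwinnertonDyer.BirchSwinnertonDyer.Theorems.Rank1ResidualX1Defs
  Summit.BirchSwinnertonDyer.BirchSwinnertonDyer.Theorems.Rank1ResidualX1RankZeroTwist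

namespace Summit.BirchSwinnertonDyer.Rank1Residual.X1.RankZeroDoubleTwist

variable {p : ℕ} [Fact p.Prime]

/-! ## §1 Keller–Yin's lattice normalisation survives a prime-to-`p` quadratic twist -/

/-- **No unramified rational `p`-line on `E` ⇒ none on `E^{(d)}`, for `p ∤ 2d`.** Along the twist
isomorphism `e : E^{(d)}[p] ≃ E[p]`, `Γ_ℚ`-equivariant up to the sign `σ√d/√d` (Silverman *AEC* X.5
Cor. 5.4; tree `exists_signEquiv_of_twist`), a rational line of `E^{(d)}[p]` maps to a rational line of
`E[p]` (`isRationalLine_map_signEquiv`), and since every inertia group above `p` fixes `√d` when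
`p ∤ 4d` (`smul_geomSqrt_eq_of_mem_inertia`) the image is unramified at `p` iff the line is
(`lineUnramifiedAt_map_signEquiv_iff`). So the good lattice's admissible twists are again good
lattices (Keller–Yin's normalisation "`E'(K)[p] = 0`", Prop. 1.3.1). [cite: SilvermanAEC2009, X.5 Cor. 5.4]
[cite: KellerYin2024, Prop. 1.3.1 (the lattice normalisation)] -/
theorem noUnramifiedLine_of_smul_eq_quadraticTwist
    {W Wd : WeierstrassCurve ℚ} [W.IsElliptic] [Wd.IsElliptic] (hp2 : p ≠ 2)
    {d : ℤ} (hd0 : d ≠ 0) (hpd : ¬ (p : ℤ) ∣ d) (C : VariableChange ℚ)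
    (hC : C • Wd = W.quadraticTwist (d : ℚ))
    (hGL : ∀ Φ : AddSubgroup (geomTorsion W (p : ℤ)), IsRationalLine W p Φ → ¬ LineUnramifiedAt W p Φ) :
    ∀ Ψ : AddSubgroup (geomTorsion Wd (p : ℤ)), IsRationalLine Wd p Ψ → ¬ LineUnramifiedAt Wd p Ψ := by
  have hd0' : ((d : ℤ) : ℚ) ≠ 0 := by exact_mod_cast hd0
  obtain ⟨e, hpos, hneg⟩ := exists_signEquiv_of_twist (W := W) (Wd := Wd) (p := p) hd0' C hC
  intro Ψ hΨ hunr
  have hΦ : IsRationalLine W p (Ψ.map e.toAddMonoidHom) :=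
    isRationalLine_map_signEquiv e (fun σ ↦ σ • geomSqrt ((d : ℤ) : ℚ) = geomSqrt ((d : ℤ) : ℚ))
      hpos hneg hΨ
  have hI : ∀ (v : HeightOneSpectrum (𝓞 ℚ)), (p : 𝓞 ℚ) ∈ v.asIdeal → ∀ 𝔓 ∈ v.primesAbove,
      ∀ σ ∈ 𝔓.inertia (absoluteGaloisGroup ℚ), σ • geomSqrt ((d : ℤ) : ℚ) = geomSqrt ((d : ℤ) : ℚ) :=
    fun v hv 𝔓 h𝔓 σ hσ ↦ smul_geomSqrt_eq_of_mem_inertia (not_dvd_four_mul hp2 hpd) hv h𝔓 hσ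
  exact hGL _ hΦ ((lineUnramifiedAt_map_signEquiv_iff e _ hpos hI Ψ).mpr hunr)

/-! ## §2 Step two: `BSD(E'^K,p)` for the rank-one TYPE-B partner from `h308` at `(E'^K, K')` and
`BSD` anywhere in the isogeny class of the double twist -/

/-- **The rank-one type-B partner of a good-lattice leaf pair satisfies `BSD(E'^K,p)`, granted `h308`
and `BSD` at one curve isogenous to an admissible DOUBLE twist.** Data: a leaf pair `(E',p)`
(`RankZero.Leaf W p`) at KY's good lattice (`hGL`); `K` imaginary quadratic with `d_K` odd and `p`
split; `Wd` a globally minimal model of `E'^{(d_K)}` with `ord_{s=1} L(E'^{(d_K)},s) = 1`; `K'`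
admissible for `E'^{(d_K)}` — `d_{K'}` odd `< -4`, Heegner for `N_{E'^K}` and for `p`,
`L(E'^{(d_K d_{K'})},1) ≠ 0`; `Wdd` a globally minimal model of the double twist and `Wc ∼ Wdd` with
`BSDp Wc p`. Inputs: `h308` (KY Thm. 3.0.8 (IMC2) at `𝟙`, PRE), CGLS Thm. 5.1.1 as proved (`h511`),
Cassels (`hCassels`), modularity (`hmodP`, `hmod`), Gross–Zagier I.7.3 (`hGZQ`), Gross–Zagier over
`K` (`hGZ`), Kolyvagin (`hKo`), GZK (`hGZK`). Chain: `Wd` is good ordinary, reducible, anomalous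
(`a_p(E'^K) = a_p(E')`), of rank one and KY-normalised (§1), so `display_at_goodLattice` at
`(Wd, p, K', Wdd)` holds; `BSDp Wdd p` by Cassels from `Wc`; its print shape `PPartRankZero Wdd p`;
`bsdp_of_display_at_of_pPartRankZero` (x1a). No Greenberg–Vatsal, no Schneider, no `σ`.
[claim: KellerYin2024, status: under-review]
[cite: KellerYin2024, Thm. 3.0.8 (IMC2) and proof of Thm. 4.2.1 (display), Prop. 1.3.1]
[cite: CastellaGrossiLeeSkinner2022, Thm. 5.3.1 and its proof ((5.4)–(5.7)), Thm. 5.1.1]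
[cite: MilneADT2006, Thm. I.7.3] -/
theorem bsdp_twist_of_h308_of_bsdp_doubleTwist
    (h308 : thm308_imc2_bdpValue_goodLattice_OPEN) (h511 : thm511_anticyclotomicControl_of_torsionFree)
    (hCassels : bsdRHS_eq_of_isIsogenous)
    (hmodP : nonempty_modularParametrizationData) (hmod : exists_isNewformOf)
    (hGZQ : GrossZagier1986_thm_I_7_3)
    (hGZ : ∀ (N : ℕ) [NeZero N] (W : WeierstrassCurve ℚ) (K : Type) [Field K] [NumberField K],
      gross_zagier N W K)
    (hKo : ∀ (N : ℕ) [NeZero N] (W : WeierstrassCurve ℚ) (K : Type) [Field K] [NumberField K],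
      kolyvagin N W K)
    (hGZK : rank_eq_analyticRank_of_analyticRank_le_one)
    (W : WeierstrassCurve ℚ) [W.IsElliptic] [W.IsGloballyMinimal] (hL : RankZero.Leaf W p)
    (hGL : ∀ Φ : AddSubgroup (geomTorsion W (p : ℤ)), IsRationalLine W p Φ → ¬ LineUnramifiedAt W p Φ)
    (K : Type) [Field K] [NumberField K] (hK : IsImaginaryQuadratic K)
    (hodd : Odd (NumberField.discr K)) (hHp : SatisfiesHeegnerHypothesis p K)
    (Wd : WeierstrassCurve ℚ) [Wd.IsElliptic] [Wd.IsGloballyMinimal]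
    (hWd : ∃ C : VariableChange ℚ, C • Wd = W.quadraticTwist (NumberField.discr K : ℚ))
    (hrd : Wd.analyticRank = 1)
    (K' : Type) [Field K'] [NumberField K'] (hK' : IsImaginaryQuadratic K')
    (hodd' : Odd (NumberField.discr K')) (hlt' : NumberField.discr K' < -4)
    (hHN' : SatisfiesHeegnerHypothesis (Wd.conductorNorm ℤ) K') (hHp' : SatisfiesHeegnerHypothesis p K')
    (hLt' : (Wd.quadraticTwist (NumberField.discr K' : ℚ)).entireLFunction 1 ≠ 0)
    (Wdd : WeierstrassCurve ℚ) [Wdd.IsElliptic] [Wdd.IsGloballyMinimal]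
    (hWdd : ∃ C' : VariableChange ℚ, C' • Wdd = Wd.quadraticTwist (NumberField.discr K' : ℚ))
    (Wc : WeierstrassCurve ℚ) [Wc.IsElliptic] [Wc.IsGloballyMinimal] (hiso : IsIsogenous Wdd Wc)
    (hBc : BSDp Wc p) : BSDp Wd p := by
  have hpP : p.Prime := Fact.out
  obtain ⟨hp, hred, hgood, han, -⟩ := hL.classX1
  have hp2 : p ≠ 2 := by omega
  have hmod' : hasEntireLFunction_rat := hasEntireLFunction_rat_of_exists_isNewformOf hmod
  obtain ⟨C, hC⟩ := hWd
  have hdneg : NumberField.discr K < 0 := IsImaginaryQuadratic.discr_neg hK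
  have hsq : Squarefree (NumberField.discr K) := squarefree_discr_of_odd hK hodd
  have hpd : ¬ (p : ℤ) ∣ NumberField.discr K := not_dvd_discr_of_split hK hpP hp2 hHp
  -- the partner `Wd`: good ordinary, reducible, anomalous, KY-normalised
  obtain ⟨hgood_d, -⟩ := RankZeroPartner.isOrdinaryAt_partner hL hsq hpd Wd hC
  have hred_d : ¬ Wd.HasIrreducibleModPGaloisRep p := RankZeroPartner.not_irr_partner hL hdneg Wd C hC
  have ha : Wd.frobeniusTrace p = W.frobeniusTrace p :=
    frobeniusTrace_eq_of_split_twist hp hgood K hK hodd hHp Wd ⟨C, hC⟩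
  have han_d : Anom Wd p := ⟨hred_d, hgood_d, by rw [ha]; exact han.2.2⟩
  have hGL_d : ∀ Ψ : AddSubgroup (geomTorsion Wd (p : ℤ)), IsRationalLine Wd p Ψ →
      ¬ LineUnramifiedAt Wd p Ψ :=
    noUnramifiedLine_of_smul_eq_quadraticTwist hp2 hdneg.ne hpd C hC hGL
  -- the double twist: analytic rank `0`, `BSDp` by Cassels from `Wc`, hence the print shape
  obtain ⟨C', hC'⟩ := hWdd
  have hLdd : Wdd.entireLFunction 1 ≠ 0 := by
    rw [← Wdd.entireLFunction_smul C', hC']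
    exact hLt'
  have hrdd : Wdd.analyticRank = 0 := analyticRank_eq_zero_of_entireLFunction_one_ne_zero hLdd
  have hrc : Wc.analyticRank = 0 := by rw [← analyticRank_eq_of_isIsogenous' hiso]; exact hrdd
  obtain ⟨-, hfin_c⟩ := hGZK Wc (by omega)
  have hlead_c : Wc.leadingLCoeff ≠ 0 := WeierstrassCurve.leadingLCoeff_ne_zero_holds (hmod' Wc)
  have hBdd : BSDp Wdd p := Wuthrich2014.bsdp_of_isIsogenous hCassels hiso hfin_c hlead_c hBc
  have hP : PPartRankZero Wdd p :=
    pPartRankZero_of_pPart hGZK Wdd p hrdd (pPart_of_bsdp hmod' hGZK Wdd p (by omega) hBdd)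
  -- Keller–Yin's display at `(Wd, p, K', Wdd)` and the conclusion
  exact bsdp_of_display_at_of_pPartRankZero hmod hGZQ hGZK Wd p hrd Wdd hP
    (display_at_goodLattice h308 h511 hmodP hGZ hKo hGZK hmod' Wd hp hgood_d hred_d han_d hGL_d hrd K'
      hK' hodd' hlt' hHN' hHp' hLt' Wdd ⟨C', hC'⟩)

/-- **The same with the finite certificate `ord_p #Ш(E_c/ℚ)_an = 0` on the isogenous curve `Wc`**
(Wuthrich 2014 Prop. 21, `hW`: at an odd non-additive prime with `ρ̄` reducible, `L(E_c,1) ≠ 0` and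
`p ∤ #Ш_an` give `BSD(E_c,p)`; `Wc` is good at `p` and reducible there, being isogenous to the double
twist). [cite: Wuthrich2014, Prop. 21 (p. 400)] [cite: KellerYin2024, Thm. 3.0.8 (IMC2)] -/
theorem bsdp_twist_of_h308_of_doubleTwist_shaAn_unit
    (h308 : thm308_imc2_bdpValue_goodLattice_OPEN) (h511 : thm511_anticyclotomicControl_of_torsionFree)
    (hW : Wuthrich2014.sha_dvd_analyticSha) (hCassels : bsdRHS_eq_of_isIsogenous)
    (hmodP : nonempty_modularParametrizationData) (hmod : exists_isNewformOf)
    (hGZQ : GrossZagier1986_thm_I_7_3)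
    (hGZ : ∀ (N : ℕ) [NeZero N] (W : WeierstrassCurve ℚ) (K : Type) [Field K] [NumberField K],
      gross_zagier N W K)
    (hKo : ∀ (N : ℕ) [NeZero N] (W : WeierstrassCurve ℚ) (K : Type) [Field K] [NumberField K],
      kolyvagin N W K)
    (hGZK : rank_eq_analyticRank_of_analyticRank_le_one)
    (W : WeierstrassCurve ℚ) [W.IsElliptic] [W.IsGloballyMinimal] (hL : RankZero.Leaf W p)
    (hGL : ∀ Φ : AddSubgroup (geomTorsion W (p : ℤ)), IsRationalLine W p Φ → ¬ LineUnramifiedAt W p Φ)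
    (K : Type) [Field K] [NumberField K] (hK : IsImaginaryQuadratic K)
    (hodd : Odd (NumberField.discr K)) (hHp : SatisfiesHeegnerHypothesis p K)
    (Wd : WeierstrassCurve ℚ) [Wd.IsElliptic] [Wd.IsGloballyMinimal]
    (hWd : ∃ C : VariableChange ℚ, C • Wd = W.quadraticTwist (NumberField.discr K : ℚ))
    (hrd : Wd.analyticRank = 1)
    (K' : Type) [Field K'] [NumberField K'] (hK' : IsImaginaryQuadratic K')
    (hodd' : Odd (NumberField.discr K')) (hlt' : NumberField.discr K' < -4)
    (hHN' : SatisfiesHeegnerHypothesis (Wd.conductorNorm ℤ) K') (hHp' : SatisfiesHeegnerHypothesis p K')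
    (hLt' : (Wd.quadraticTwist (NumberField.discr K' : ℚ)).entireLFunction 1 ≠ 0)
    (Wdd : WeierstrassCurve ℚ) [Wdd.IsElliptic] [Wdd.IsGloballyMinimal]
    (hWdd : ∃ C' : VariableChange ℚ, C' • Wdd = Wd.quadraticTwist (NumberField.discr K' : ℚ))
    (Wc : WeierstrassCurve ℚ) [Wc.IsElliptic] [Wc.IsGloballyMinimal] (hiso : IsIsogenous Wdd Wc)
    (hunit : ∃ q : ℚ, shaAn Wc = (q : ℂ) ∧ padicValRat p q = 0) : BSDp Wd p := by
  have hpP : p.Prime := Fact.out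
  obtain ⟨hp, hred, hgood, han, -⟩ := hL.classX1
  have hp2 : p ≠ 2 := by omega
  obtain ⟨C, hC⟩ := hWd
  obtain ⟨C', hC'⟩ := hWdd
  have hdneg : NumberField.discr K < 0 := IsImaginaryQuadratic.discr_neg hK
  have hsq : Squarefree (NumberField.discr K) := squarefree_discr_of_odd hK hodd
  have hpd : ¬ (p : ℤ) ∣ NumberField.discr K := not_dvd_discr_of_split hK hpP hp2 hHp
  have hdneg' : NumberField.discr K' < 0 := IsImaginaryQuadratic.discr_neg hK'
  have hsq' : Squarefree (NumberField.discr K') := squarefree_discr_of_odd hK' hodd'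
  have hpd' : ¬ (p : ℤ) ∣ NumberField.discr K' := not_dvd_discr_of_split hK' hpP hp2 hHp'
  -- `Wd`, then `Wdd`, then `Wc`: good (ordinary) at `p` and reducible there
  have hord_d : IsOrdinaryAt Wd p := RankZeroPartner.isOrdinaryAt_partner hL hsq hpd Wd hC
  have hred_d : ¬ Wd.HasIrreducibleModPGaloisRep p := RankZeroPartner.not_irr_partner hL hdneg Wd C hC
  obtain ⟨hgood_dd, -⟩ := isOrdinaryAt_of_smul_eq_quadraticTwist Wd Wdd hsq' hC' p hp2 hpd' hord_d
  have hred_dd : ¬ Wdd.HasIrreducibleModPGaloisRep p :=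
    not_hasIrreducibleModPGaloisRep_twist hred_d (show ((NumberField.discr K' : ℤ) : ℚ) ≠ 0 by
      exact_mod_cast hdneg'.ne) Wdd C' hC'
  have hgood_c : Wc.HasGoodReductionAtPrime p := (hiso.hasGoodReductionAtPrime_iff p).mp hgood_dd
  have hadd_c : ¬ ((Wc.baseChange ℚ_[p]).minimal ℤ_[p]).HasAdditiveReduction ℤ_[p] :=
    WeierstrassCurve.HasGoodReduction.not_hasAdditiveReduction (R := ℤ_[p]) hgood_c
  have hred_c : ¬ Wc.HasIrreducibleModPGaloisRep p :=
    not_hasIrreducibleModPGaloisRep_of_isIsogenous hiso hred_dd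
  have hLc : Wc.entireLFunction 1 ≠ 0 := by
    rw [← entireLFunction_eq_of_isIsogenous' hiso, ← Wdd.entireLFunction_smul C', hC']
    exact hLt'
  have hBc : BSDp Wc p :=
    Wuthrich2014.bsdp_of_L_one_ne_zero_of_padicValRat_shaAn_eq_zero hW hGZK Wc p hp2 hLc hadd_c
      (Or.inl hred_c) hunit
  exact bsdp_twist_of_h308_of_bsdp_doubleTwist h308 h511 hCassels hmodP hmod hGZQ hGZ hKo hGZK W hL hGL
    K hK hodd hHp Wd ⟨C, hC⟩ hrd K' hK' hodd' hlt' hHN' hHp' hLt' Wdd ⟨C', hC'⟩ Wc hiso hBc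


/-! ## §3 Both displays: `BSD(E',p)` at a good-lattice leaf pair from `h308` (twice) and `BSD` in the
isogeny class of an admissible double twist; the certificate datum -/

/-- **`BSD(E',p)` at a good-lattice LEAF pair from `h308` and `BSD` at one curve isogenous to an
admissible double twist — both displays, no Schneider, no `p`-adic height.** Data as in
`bsdp_twist_of_h308_of_bsdp_doubleTwist`, with `K` now fully admissible for `E'` (`d_K < -4`, Heegner
for `N_{E'}`). Step one is the SWAPPED display at the good lattice
(`RankZeroGoodLatticeDisplay.displaySwap_at_goodLattice`: `def_p(E') + def_p(E'^K) = 0`) and ky's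
bookkeeping `bsdp_rankZero_of_displaySwap_of_bsdp_twist` (`L(E',1)/Ω ∈ ℚ` by modular symbols); step
two is §2. [claim: KellerYin2024, status: under-review]
[cite: KellerYin2024, Thm. 3.0.8 (IMC2) and proof of Thm. 4.2.1 (display, both orientations)]
[cite: CastellaGrossiLeeSkinner2022, Thm. 5.3.1 and its proof, Thm. 5.1.1] [cite: MilneADT2006, Thm. I.7.3] -/
theorem Leaf.bsdp_goodLattice_of_h308_of_bsdp_doubleTwist
    (h308 : thm308_imc2_bdpValue_goodLattice_OPEN) (h511 : thm511_anticyclotomicControl_of_torsionFree)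
    (hCassels : bsdRHS_eq_of_isIsogenous)
    (hmodP : nonempty_modularParametrizationData) (hmod : exists_isNewformOf)
    (hGZQ : GrossZagier1986_thm_I_7_3)
    (hGZ : ∀ (N : ℕ) [NeZero N] (W : WeierstrassCurve ℚ) (K : Type) [Field K] [NumberField K],
      gross_zagier N W K)
    (hKo : ∀ (N : ℕ) [NeZero N] (W : WeierstrassCurve ℚ) (K : Type) [Field K] [NumberField K],
      kolyvagin N W K)
    (hGZK : rank_eq_analyticRank_of_analyticRank_le_one)
    (W : WeierstrassCurve ℚ) [W.IsElliptic] [W.IsGloballyMinimal] (hL : RankZero.Leaf W p)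
    (hGL : ∀ Φ : AddSubgroup (geomTorsion W (p : ℤ)), IsRationalLine W p Φ → ¬ LineUnramifiedAt W p Φ)
    (K : Type) [Field K] [NumberField K] (hK : IsImaginaryQuadratic K)
    (hodd : Odd (NumberField.discr K)) (hlt : NumberField.discr K < -4)
    (hHN : SatisfiesHeegnerHypothesis (W.conductorNorm ℤ) K) (hHp : SatisfiesHeegnerHypothesis p K)
    (Wd : WeierstrassCurve ℚ) [Wd.IsElliptic] [Wd.IsGloballyMinimal]
    (hWd : ∃ C : VariableChange ℚ, C • Wd = W.quadraticTwist (NumberField.discr K : ℚ))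
    (hrd : Wd.analyticRank = 1)
    (K' : Type) [Field K'] [NumberField K'] (hK' : IsImaginaryQuadratic K')
    (hodd' : Odd (NumberField.discr K')) (hlt' : NumberField.discr K' < -4)
    (hHN' : SatisfiesHeegnerHypothesis (Wd.conductorNorm ℤ) K') (hHp' : SatisfiesHeegnerHypothesis p K')
    (hLt' : (Wd.quadraticTwist (NumberField.discr K' : ℚ)).entireLFunction 1 ≠ 0)
    (Wdd : WeierstrassCurve ℚ) [Wdd.IsElliptic] [Wdd.IsGloballyMinimal]
    (hWdd : ∃ C' : VariableChange ℚ, C' • Wdd = Wd.quadraticTwist (NumberField.discr K' : ℚ))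
    (Wc : WeierstrassCurve ℚ) [Wc.IsElliptic] [Wc.IsGloballyMinimal] (hiso : IsIsogenous Wdd Wc)
    (hBc : BSDp Wc p) : BSDp W p := by
  obtain ⟨hp, hred, hgood, han, -⟩ := hL.classX1
  have hmod' : hasEntireLFunction_rat := hasEntireLFunction_rat_of_exists_isNewformOf hmod
  -- step two: `BSD(E'^K,p)`
  have hBd : BSDp Wd p := bsdp_twist_of_h308_of_bsdp_doubleTwist h308 h511 hCassels hmodP hmod hGZQ
    hGZ hKo hGZK W hL hGL K hK hodd hHp Wd hWd hrd K' hK' hodd' hlt' hHN' hHp' hLt' Wdd hWdd Wc hiso hBc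
  -- step one: the swapped display at the good lattice, then ky's bookkeeping
  exact bsdp_rankZero_of_displaySwap_of_bsdp_twist hmod' hGZK W p hL.analyticRank_eq_zero
    (RankZeroPartner.exists_rat_entireLFunction_one_div_realPeriodRat hmodP W) Wd (by omega) hBd
    (RankZeroGoodLatticeDisplay.displaySwap_at_goodLattice h308 h511 hmodP hGZ hKo hGZK hmod' W hp
      hgood hred han hGL hL.analyticRank_eq_zero K hK hodd hlt hHN hHp Wd hWd hrd)

/-- **The DOUBLE-TWIST CERTIFICATE DATUM at `(W, p)` (TYPED; nothing asserted).** There are: an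
admissible `K` for `W` (`d_K` odd `< -4`, every prime of `N_W` and `p` split) with a globally
minimal model `Wd` of `W^{(d_K)}` of analytic rank ONE; an admissible `K'` for `Wd` (`d_{K'}` odd
`< -4`, every prime of `N_{W^{(d_K)}}` and `p` split, `L(W^{(d_K d_{K'})},1) ≠ 0`) with a globally
minimal model `Wdd` of the double twist; and a globally minimal elliptic `Wc` isogenous to `Wdd` over
`ℚ` whose analytic order of `Ш`, `#Ш(E_c/ℚ)_an = L(E_c,1)·#E_c(ℚ)_tors² / (Ω_{E_c} ∏ c_ℓ)` (Miller
2011 §1, `shaAn`), is a rational number of `p`-adic valuation `0`. Per pair these are finite data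
(two discriminants, two ranks read off `L`-values, one exact rational); the first five clauses hold
for infinitely many `K` at every leaf pair (Bump–Friedberg–Hoffstein, `RankZeroPartner.exists_admissibleField_analyticRank_eq_one`).
The ISOGENOUS `Wc` is essential: on the good lattice's own twists `#Ш_an` carries the lattice's
`μ`-invariant (e.g. `11a2 @ 5`, `μ = 2`). Route (B-ii) of the cell.
[cite: Wuthrich2014, Prop. 21 (p. 400)] [cite: Miller2011LMS, §1 and Def. 1.1] -/
def DoubleTwistPartnerAt (W : WeierstrassCurve ℚ) [W.IsElliptic] (p : ℕ) [Fact p.Prime] : Prop :=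
  ∃ (K : Type) (_ : Field K) (_ : NumberField K), IsImaginaryQuadratic K ∧
    Odd (NumberField.discr K) ∧ NumberField.discr K < -4 ∧
    SatisfiesHeegnerHypothesis (W.conductorNorm ℤ) K ∧ SatisfiesHeegnerHypothesis p K ∧
    ∃ (Wd : WeierstrassCurve ℚ) (_ : Wd.IsElliptic) (_ : Wd.IsGloballyMinimal),
      (∃ C : VariableChange ℚ, C • Wd = W.quadraticTwist (NumberField.discr K : ℚ)) ∧
      Wd.analyticRank = 1 ∧
      ∃ (K' : Type) (_ : Field K') (_ : NumberField K'), IsImaginaryQuadratic K' ∧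
        Odd (NumberField.discr K') ∧ NumberField.discr K' < -4 ∧
        SatisfiesHeegnerHypothesis (Wd.conductorNorm ℤ) K' ∧ SatisfiesHeegnerHypothesis p K' ∧
        (Wd.quadraticTwist (NumberField.discr K' : ℚ)).entireLFunction 1 ≠ 0 ∧
        ∃ (Wdd : WeierstrassCurve ℚ) (_ : Wdd.IsElliptic) (_ : Wdd.IsGloballyMinimal),
          (∃ C' : VariableChange ℚ, C' • Wdd = Wd.quadraticTwist (NumberField.discr K' : ℚ)) ∧
          ∃ (Wc : WeierstrassCurve ℚ) (_ : Wc.IsElliptic) (_ : Wc.IsGloballyMinimal),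
            IsIsogenous Wdd Wc ∧ ∃ q : ℚ, shaAn Wc = (q : ℂ) ∧ padicValRat p q = 0

/-- **`BSD(E',p)` at a good-lattice leaf pair carrying the double-twist certificate**, granted
`h308` (KY Thm. 3.0.8 (IMC2) at `𝟙`, PRE) and the PUBLISHED facts (CGLS 5.1.1 `h511`, Wuthrich
Prop. 21 `hW`, Cassels `hCassels`, modularity `hmodP`/`hmod`, Gross–Zagier `hGZQ`/`hGZ`, Kolyvagin
`hKo`, GZK `hGZK`). [claim: KellerYin2024, status: under-review]
[cite: KellerYin2024, Thm. 3.0.8 (IMC2) and proof of Thm. 4.2.1] [cite: Wuthrich2014, Prop. 21 (p. 400)]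
[cite: CastellaGrossiLeeSkinner2022, Thm. 5.3.1 and its proof, Thm. 5.1.1] -/
theorem Leaf.bsdp_goodLattice_of_h308_of_doubleTwistPartnerAt
    (h308 : thm308_imc2_bdpValue_goodLattice_OPEN) (h511 : thm511_anticyclotomicControl_of_torsionFree)
    (hW : Wuthrich2014.sha_dvd_analyticSha) (hCassels : bsdRHS_eq_of_isIsogenous)
    (hmodP : nonempty_modularParametrizationData) (hmod : exists_isNewformOf)
    (hGZQ : GrossZagier1986_thm_I_7_3)
    (hGZ : ∀ (N : ℕ) [NeZero N] (W : WeierstrassCurve ℚ) (K : Type) [Field K] [NumberField K],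
      gross_zagier N W K)
    (hKo : ∀ (N : ℕ) [NeZero N] (W : WeierstrassCurve ℚ) (K : Type) [Field K] [NumberField K],
      kolyvagin N W K)
    (hGZK : rank_eq_analyticRank_of_analyticRank_le_one)
    (W : WeierstrassCurve ℚ) [W.IsElliptic] [W.IsGloballyMinimal] (hL : RankZero.Leaf W p)
    (hGL : ∀ Φ : AddSubgroup (geomTorsion W (p : ℤ)), IsRationalLine W p Φ → ¬ LineUnramifiedAt W p Φ)
    (hDT : DoubleTwistPartnerAt W p) : BSDp W p := by
  obtain ⟨hp, hred, hgood, han, -⟩ := hL.classX1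
  have hmod' : hasEntireLFunction_rat := hasEntireLFunction_rat_of_exists_isNewformOf hmod
  obtain ⟨K, _, _, hK, hodd, hlt, hHN, hHp, Wd, _, _, hWd, hrd, K', _, _, hK', hodd', hlt', hHN', hHp',
    hLt', Wdd, _, _, hWdd, Wc, _, _, hiso, hunit⟩ := hDT
  have hBd : BSDp Wd p := bsdp_twist_of_h308_of_doubleTwist_shaAn_unit h308 h511 hW hCassels hmodP
    hmod hGZQ hGZ hKo hGZK W hL hGL K hK hodd hHp Wd hWd hrd K' hK' hodd' hlt' hHN' hHp' hLt' Wdd hWdd Wc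
    hiso hunit
  exact bsdp_rankZero_of_displaySwap_of_bsdp_twist hmod' hGZK W p hL.analyticRank_eq_zero
    (RankZeroPartner.exists_rat_entireLFunction_one_div_realPeriodRat hmodP W) Wd (by omega) hBd
    (RankZeroGoodLatticeDisplay.displaySwap_at_goodLattice h308 h511 hmodP hGZ hKo hGZK hmod' W hp
      hgood hred han hGL hL.analyticRank_eq_zero K hK hodd hlt hHN hHp Wd hWd hrd)

end Summit.BirchSwinnertonDyer.Rank1Residual.X1.RankZeroDoubleTwist

end
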